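/-
Copyright (c) 2026. All rights reserved.
Released under Apache 2.0 license as described in the file LICENSE.
Authors: abc-iut cell — seat abc-iut-f-104 (F fact-proving wave, tranche 104: FACT-LIST rows F-0176, F-0181,
F-0182, F-0183 of `PanalocalTheaters.lean`).
-/
import Literature.AnabelianGeometry.AbsoluteAnabelian.PanalocalTheatersGeneric
import Literature.AnabelianGeometry.AbsoluteAnabelian.MLFAbsoluteGaloisGroupInfinite
import Literature.AnabelianGeometry.AbsoluteAnabelian.TMMonoNonVacuity
import HarnessLib

/-!
# [AbsTopIII] Def 5.1 (ii), (iv), Cor 5.2 (v), Def 5.6 (ii): the universal closures of the named facts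
# `AutRel`, `PanalocalizationExists`, `PanalocalizationMapsHom`, `MonoAnalyticizationExists` over the interface
# context are FALSE — explicit countermodel contexts

S. Mochizuki, *Topics in absolute anabelian geometry III* [MochizukiAbsTopIII2015], Def 5.1 (ii) p. 115, (iv) p. 116,
Cor 5.2 (v) p. 120, Def 5.6 (ii) p. 135 (manuscript pages, as in `PanalocalTheaters.lean`; journal pp. 1091–1093).

PROOF-ONLY companion (no `def` / `structure` / `instance`) for the FROZEN FACT-LIST rows **F-0176**
`GlobalAnabelianContext.AutRel`, **F-0181** `MonoAnalyticizationExists`, **F-0182** `PanalocalizationExists`, **F-0183**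
`PanalocalizationMapsHom` (`kernel_closedness = parametrised`).  Per R5 a universal closure of a schema is not a
fact; this file DECIDES the four universal closures over the interface context `R : GlobalAnabelianContext` — all
four are REFUTED at universe `0` by explicit contexts — and isolates in each case the interface datum that print
supplies and the record `GlobalAnabelianContext` (abc-iut-L4-t3) leaves free:

* §1 (every context): `PanalocalizationMapsHom.nonempty_iso_archSpace` — if `V(Π)^arc` is one `Aut(Π)`-class and
  `Aut(Π)` respects `{⊚} ∪ V^non ∪ V^arc`, the weak morphism part of Cor 5.2 (v) forces all `X(Π, ṽ)` (`ṽ`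
  archimedean) to be isomorphic (two panalocalizations of the same `V⊚(Π)` choosing different lifts, related by the
  morphism induced by `𝟙 Π`).
* §2 the context `R✗` ("`Aut(Π)` swaps the two archimedean elements"): `Ob(EA⊚) := {Π = 1}`, `k_NF := ℚ`,
  `V⊚(Π) := {⊚, n, a, a′}` (trivial action) with `V^non = {n}`, `V^arc = {a, a′}`, `V⊚(f) := (a a′)` for EVERY morphism
  `f`, `X(Π, a)` with one point and `X(Π, a′)` with two.  There: F-0182 HOLDS (by `panalocalizationExists_of_mapProVal_mem`:
  the swap respects the decomposition) — so nothing below is vacuous —, while `¬ AutRel(⊚, n)` (F-0176's closure),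
  NO panalocal Galois-theater with a nonarchimedean element has a mono-analyticization (F-0181: `G_n = aug(Π_n) = 1` is
  finite, and the absolute Galois group of an MLF is infinite, `IsMLF.infinite_absoluteGaloisGroup`), and
  `¬ PanalocalizationMapsHom R✗` (F-0183: `X(Π, a) ≇ X(Π, a′)` although `a′ = (a a′)·a`).
* §3 the context `R₀` ("`Aut(Π)` swaps `⊚` with the nonarchimedean element"): `V⊚(Π) := {⊚, n}`, `V⊚(f) := (⊚ n)`;
  there `[⊚] = [n]` in `V⊚(Π)/Aut(Π)`, so NO panalocalization of `V⊚(Π)` exists (F-0182's closure; condition (a) of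
  Def 5.1 (iv) with `⊚_V ∉ V^non`).
* §4 the four headline refutations `not_forall_autRel`, `not_forall_panalocalizationExists`,
  `not_forall_panalocalizationMapsHom`, `not_forall_monoAnalyticizationExists` (the last one closed using the
  degenerate datum `ArchMonoAnalyticization.nonempty_degenerate`).

WHAT THIS SAYS (and does not say): the interface records `V⊚(f)` (`mapProVal`) without identity / composition laws
and without compatibility with `⊚ / non / arc`, records `X(Π, ṽ)` (`archSpace`) as free data per archimedean element,
and does not tie `aug(Π_ṽ)` to an MLF; print has all three (Def 5.1 (ii): "`Aut(Π_X)` acts naturally on all of these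
objects", `V⊚(Π_X)/Aut(Π_X) ≅ V⊚(F_mod)`; `X(Π_X, v) = X_{ell,v}` of Cor 2.8; `G_v = Gal(F̄_v/F_v)`).  So the four rows
are SCHEMATA whose instance forms are the hypotheses-carrying theorems of `PanalocalTheatersGeneric.lean`; nothing of
[AbsTopIII] is refuted; DEGENERATE contexts (no hyperbolic orbicurve has `Π = 1`); no side is taken on, and nothing
here bears on, [IUTchIII] Cor. 3.12; typed ≠ proved.
-/

set_option autoImplicit false

namespace Literature.AnabelianGeometry.AbsoluteAnabelian

open CategoryTheory Topology

universe u

/-! ### §1 (F-0183): a necessary condition for the weak morphism part, valid for every context -/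

/-- **F-0183, NECESSARY form.** Suppose `Aut(Π)` respects `{⊚} ∪ V^non ∪ V^arc` for the admissible `Π` and
`V(Π)^arc` is a SINGLE `Aut(Π)`-class. If morphisms of `EA⊚` induce morphisms between panalocalizations
(`PanalocalizationMapsHom R`), then ALL the Aut-holomorphic orbispaces `X(Π, ṽ)`, `ṽ ∈ V(Π)^arc`, are isomorphic:
the identity `𝟙 Π` must induce a morphism between the two panalocalizations of `V⊚(Π)` that choose `X_v := X(Π, ã)`
resp. `X_v := X(Π, b̃)` at the unique archimedean `v`, and a morphism carries an isomorphism `(X₁)_{v} ≅ (X₂)_{v}`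
(Def 5.1 (iv)). In print `X(Π, ṽ) ≅ X(Π, α·ṽ)` by functoriality of Cor 2.8; the interface records `X(Π, ṽ)` as free
data. [cite: MochizukiAbsTopIII2015, Def 5.1 (iv) p. 116] -/
theorem PanalocalizationMapsHom.nonempty_iso_archSpace {R : GlobalAnabelianContext.{u}}
    (h : PanalocalizationMapsHom R) {E : FundamentalExtension.{u}} (hE : R.IsAdmissible E)
    (hgen : ∀ (α : E ≅ E) (hα : IsEAHom α.hom),
      R.mapProVal α.hom hα (R.proVal E).generic = (R.proVal E).generic)
    (hnon : ∀ (α : E ≅ E) (hα : IsEAHom α.hom) (v : (R.proVal E).carrier),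
      v ∈ (R.proVal E).non → R.mapProVal α.hom hα v ∈ (R.proVal E).non)
    (harc : ∀ (α : E ≅ E) (hα : IsEAHom α.hom) (v : (R.proVal E).carrier),
      v ∈ (R.proVal E).arc → R.mapProVal α.hom hα v ∈ (R.proVal E).arc)
    (hone : ∀ a b : (R.proVal E).arc, R.toModAut E a.1 = R.toModAut E b.1) (a b : (R.proVal E).arc) :
    Nonempty (AutHolOrbispace.Iso (R.archSpace E a) (R.archSpace E b)) := by
  have hn : ∀ q : ↥(R.toModAut E '' (R.proVal E).non),
      ∃ vl, vl ∈ (R.proVal E).non ∧ R.toModAut E vl = q.1 := fun q => q.2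
  choose ln hln_mem hln_eq using hn
  have href : ∀ c : (R.proVal E).arc, IsPanalocalReferenceFor R (R.toModAut E (R.proVal E).generic)
      (R.toModAut E '' (R.proVal E).non) (R.toModAut E '' (R.proVal E).arc) (fun q => R.decompGrp E (ln q))
      (fun _ => R.archSpace E c) E (Equiv.refl _) := fun c =>
    ⟨rfl, fun v hv => Set.mem_image_of_mem _ hv, fun v hv => Set.mem_image_of_mem _ hv,
      fun q => ⟨ln q, hln_mem q, hln_eq q, ⟨ContinuousMulEquiv.refl _⟩⟩,
      fun q => ⟨c, by
        obtain ⟨w, hw, hq⟩ := q.2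
        exact (hone c ⟨w, hw⟩).trans hq, ⟨⟨Homeomorph.refl _, RingEquiv.refl _, ContinuousMulEquiv.refl _⟩⟩⟩⟩
  let mkP : (R.proVal E).arc → PanalocalGaloisTheater R := fun c =>
    { V := R.ProValModAut E
      generic := R.toModAut E (R.proVal E).generic
      non := R.toModAut E '' (R.proVal E).non
      arc := R.toModAut E '' (R.proVal E).arc
      generic_notMem_non := GlobalAnabelianContext.toModAut_generic_notMem_image_non hgen hnon harc
      generic_notMem_arc := GlobalAnabelianContext.toModAut_generic_notMem_image_arc hgen hnon harc
      disjoint_non_arc := GlobalAnabelianContext.disjoint_image_non_image_arc hgen hnon harc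
      eq_generic_or_mem := R.eq_toModAut_generic_or_mem_image
      grp := fun q => R.decompGrp E (ln q)
      X := fun _ => R.archSpace E c
      exists_reference := ⟨E, hE, Equiv.refl _, href c⟩ }
  have hP : ∀ c, (mkP c).IsPanalocalizationOf E := fun c => ⟨hE, Equiv.refl _, href c⟩
  obtain ⟨φ⟩ := h E E (mkP a) (mkP b) (hP a) (hP b) (𝟙 E) (isEAHom_id E)
  exact ⟨φ.archIso ⟨R.toModAut E a.1, Set.mem_image_of_mem _ a.2⟩⟩


/-! ### §2 The context `R✗`: `Aut(Π)` swaps the two archimedean elements -/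

/-- **The context `R✗`.** There is a context `R` (universe `0`) with an admissible `Π` (`= 1`) such that: admissible
extensions have trivial `G`; `Aut(Π′)` respects `⊚ / non / arc` for every `Π′`; `V⊚(Π)` has a nonarchimedean element;
some pair of elements of `V⊚(Π)` is NOT `AutRel`-related; `V(Π)^arc` is a single `Aut(Π)`-class; and two archimedean
elements of `V⊚(Π)` have NON-isomorphic `X(Π, ṽ)`.  Construction: `V⊚(Π′) := {0 = ⊚, 1 ∈ V^non, 2, 3 ∈ V^arc}` with
trivial action, `V⊚(f) :=` the transposition `(2 3)` for every `f`, `X(Π′, ṽ) :=` the space `{x | x = 2 ∨ x = ṽ}`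
(field `ℚ`, `π₁^∧ := Δ`), `k_NF := ℚ`, `Ob(EA⊚) := {Π′ : Π′ = 1}`. DEGENERATE, for deciding universal closures only.
[cite: MochizukiAbsTopIII2015, Def 5.1 (ii) p. 114] -/
theorem GlobalAnabelianContext.exists_context_arcSwap :
    ∃ (R : GlobalAnabelianContext.{0}) (E : FundamentalExtension.{0}), R.IsAdmissible E ∧
      (∀ E', R.IsAdmissible E' → Subsingleton E'.gal) ∧
      (∀ (E' : FundamentalExtension.{0}) (α : E' ≅ E') (hα : IsEAHom α.hom),
        R.mapProVal α.hom hα (R.proVal E').generic = (R.proVal E').generic) ∧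
      (∀ (E' : FundamentalExtension.{0}) (α : E' ≅ E') (hα : IsEAHom α.hom) (v : (R.proVal E').carrier),
        v ∈ (R.proVal E').non → R.mapProVal α.hom hα v ∈ (R.proVal E').non) ∧
      (∀ (E' : FundamentalExtension.{0}) (α : E' ≅ E') (hα : IsEAHom α.hom) (v : (R.proVal E').carrier),
        v ∈ (R.proVal E').arc → R.mapProVal α.hom hα v ∈ (R.proVal E').arc) ∧
      (∃ v, v ∈ (R.proVal E).non) ∧
      (∃ v w : (R.proVal E).carrier, ¬ R.AutRel E v w) ∧
      (∀ a b : (R.proVal E).arc, R.toModAut E a.1 = R.toModAut E b.1) ∧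
      ∃ a b : (R.proVal E).arc, ¬ Nonempty (AutHolOrbispace.Iso (R.archSpace E a) (R.archSpace E b)) := by
  classical
  -- the trivial extension `Π = G = 1`
  let E₁ : FundamentalExtension.{0} :=
    { arith := ProfiniteGrp.of PUnit.{1}, gal := ProfiniteGrp.of PUnit.{1},
      aug := ContinuousMonoidHom.id _, aug_surjective := Function.surjective_id }
  -- admissibility `Π = 1` is isomorphism-stable and makes `Δ = 1` the maximal tfg closed normal subgroup
  have hiso : ∀ {F₁ F₂ : FundamentalExtension.{0}}, Nonempty (F₁ ≅ F₂) →
      Subsingleton F₁.arith → Subsingleton F₂.arith := by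
    rintro F₁ F₂ ⟨e⟩ h
    refine ⟨fun a b => ?_⟩
    have ha : (e.inv ≫ e.hom).arith a = a := by rw [e.inv_hom_id]; rfl
    have hb : (e.inv ≫ e.hom).arith b = b := by rw [e.inv_hom_id]; rfl
    rw [← ha, ← hb, FundamentalExtension.comp_arith]
    exact congrArg e.hom.arith (Subsingleton.elim _ _)
  have hmax : ∀ F : FundamentalExtension.{0}, Subsingleton F.arith → IsMaxTopFGClosedNormal F.geom := by
    intro F hF
    exact
      { normal := inferInstanceAs F.aug.toMonoidHom.ker.Normal
        isClosed := F.isClosed_geom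
        topFG := ⟨∅, eq_top_iff.mpr fun x _ => by rw [Subsingleton.elim x 1]; exact one_mem _⟩
        maximal := fun N _ _ _ x _ => by rw [Subsingleton.elim x 1]; exact one_mem _ }
  -- the pro-sets `{⊚ = 0, 1 ∈ non, 2, 3 ∈ arc}` with trivial action
  let V : ∀ F : FundamentalExtension.{0}, GaloisProSet F.arith := fun F =>
    letI : MulAction F.arith (Fin 4) :=
      { smul := fun _ v => v, one_smul := fun _ => rfl, mul_smul := fun _ _ _ => rfl }
    haveI : ContinuousSMul F.arith (Fin 4) := ⟨continuous_snd⟩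
    { carrier := Fin 4
      generic := 0
      non := {1}
      arc := {2, 3}
      smul_generic := fun _ => rfl
      generic_notMem_non := by simp
      generic_notMem_arc := by simp
      disjoint_non_arc := by simp
      eq_generic_or_mem := fun v => by fin_cases v <;> simp
      smul_mem_non := fun _ _ h => h
      smul_mem_arc := fun _ _ h => h }
  -- `X(Π, ṽ)`: one point over `2`, two points over `3`; `π₁^∧ := Δ`
  let X : ∀ (F : FundamentalExtension.{0}) (v : (V F).arc), AutHolOrbispace.{0} := fun F v =>
    { carrier := {x : Fin 4 // x = 2 ∨ x = v.1}
      fieldA := ℚ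
      pi1Hat := F.geomGrp }
  -- `V⊚(f) := (2 3)`
  let σ : Fin 4 ≃ₜ Fin 4 :=
    { Equiv.swap (2 : Fin 4) 3 with
      continuous_toFun := continuous_of_discreteTopology
      continuous_invFun := continuous_of_discreteTopology }
  refine ⟨{ IsAdmissible := fun F => Subsingleton F.arith
            isAdmissible_of_iso := hiso
            geom_isMax := hmax
            kNF := fun _ => ℚ
            instField := fun _ => inferInstance
            instAction := fun F => MulSemiringAction.compHom _ (1 : F.arith →* (ℚ →+* ℚ))
            proVal := V
            archSpace := X
            δell := fun F _ => ContinuousMulEquiv.refl _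
            κell := fun _ _ => RingHom.id ℚ
            mapProVal := fun _ _ => σ
            mapProVal_smul := fun _ _ _ _ => rfl
            mapKNF := fun _ _ => RingEquiv.refl ℚ },
    E₁, inferInstanceAs (Subsingleton PUnit), ?_, ?_, ?_, ?_, ⟨1, rfl⟩, ⟨0, 1, ?_⟩, ?_, ?_⟩
  · -- admissible `Π′ = 1` ⟹ `G′ = 1`
    intro F hF
    refine ⟨fun a b => ?_⟩
    obtain ⟨x, rfl⟩ := F.aug_surjective a
    obtain ⟨y, rfl⟩ := F.aug_surjective b
    rw [Subsingleton.elim x y]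
  · -- `(2 3)` fixes `⊚ = 0`
    intro F α hα
    have h02 : (0 : Fin 4) ≠ 2 := by decide
    have h03 : (0 : Fin 4) ≠ 3 := by decide
    exact Equiv.swap_apply_of_ne_of_ne h02 h03
  · -- `(2 3)` preserves `non = {1}`
    intro F α hα v hv
    have hv' : v = 1 := hv
    subst hv'
    have h12 : (1 : Fin 4) ≠ 2 := by decide
    have h13 : (1 : Fin 4) ≠ 3 := by decide
    exact Equiv.swap_apply_of_ne_of_ne h12 h13
  · -- `(2 3)` preserves `arc = {2, 3}`
    intro F α hα v hv
    have hv' : v = 2 ∨ v = 3 := hv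
    rcases hv' with rfl | rfl
    · exact Or.inr (Equiv.swap_apply_left _ _)
    · exact Or.inl (Equiv.swap_apply_right _ _)
  · -- `⊚ = 0` and `1` are not `AutRel`-related: `(2 3) 0 = 0 ≠ 1`
    rintro ⟨α, hα, h⟩
    have h01 : (Equiv.swap (2 : Fin 4) 3) 0 ≠ 1 := by decide
    exact h01 h
  · -- `V(Π)^arc = {2, 3}` is one `Aut(Π)`-class: `3 = (2 3)·2`
    rintro ⟨a, ha⟩ ⟨b, hb⟩
    have ha' : a = 2 ∨ a = 3 := ha
    have hb' : b = 2 ∨ b = 3 := hb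
    rcases ha' with rfl | rfl <;> rcases hb' with rfl | rfl
    · rfl
    · refine Quot.sound ?_
      exact ⟨Iso.refl E₁, isEAHom_id E₁, Equiv.swap_apply_left _ _⟩
    · refine (Quot.sound ?_).symm
      exact ⟨Iso.refl E₁, isEAHom_id E₁, Equiv.swap_apply_left _ _⟩
    · rfl
  · -- `X(Π, 2)` has one point, `X(Π, 3)` has two
    refine ⟨⟨2, Or.inl rfl⟩, ⟨3, Or.inr rfl⟩, ?_⟩
    rintro ⟨i⟩
    have e : {x : Fin 4 // x = 2 ∨ x = 2} ≃ {x : Fin 4 // x = 2 ∨ x = 3} := i.toHomeomorph.toEquiv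
    have hcard : Fintype.card {x : Fin 4 // x = 2 ∨ x = 2} ≠ Fintype.card {x : Fin 4 // x = 2 ∨ x = 3} := by
      decide
    exact hcard (Fintype.card_congr e)

/-! ### §3 The context `R₀`: `Aut(Π)` swaps `⊚` with the nonarchimedean element -/

/-- **The context `R₀`.** There is a context `R` (universe `0`) with an admissible `Π` (`= 1`) and a nonarchimedean
`n ∈ V⊚(Π)` whose class in `V⊚(Π)/Aut(Π)` is the class of `⊚`: `V⊚(Π′) := {⊚ = false, n = true}`, trivial action,
`V⊚(f) :=` Boolean negation for every `f` (nothing in the interface relates `V⊚(f)` to `⊚ / non / arc`), no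
archimedean elements, `k_NF := ℚ`, `Ob(EA⊚) := {Π′ = 1}`. DEGENERATE, for deciding F-0182's universal closure only.
[cite: MochizukiAbsTopIII2015, Def 5.1 (ii) p. 114] -/
theorem GlobalAnabelianContext.exists_context_genericSwap :
    ∃ (R : GlobalAnabelianContext.{0}) (E : FundamentalExtension.{0}), R.IsAdmissible E ∧
      ∃ v, v ∈ (R.proVal E).non ∧ R.toModAut E v = R.toModAut E (R.proVal E).generic := by
  let E₁ : FundamentalExtension.{0} :=
    { arith := ProfiniteGrp.of PUnit.{1}, gal := ProfiniteGrp.of PUnit.{1},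
      aug := ContinuousMonoidHom.id _, aug_surjective := Function.surjective_id }
  have hiso : ∀ {F₁ F₂ : FundamentalExtension.{0}}, Nonempty (F₁ ≅ F₂) →
      Subsingleton F₁.arith → Subsingleton F₂.arith := by
    rintro F₁ F₂ ⟨e⟩ h
    refine ⟨fun a b => ?_⟩
    have ha : (e.inv ≫ e.hom).arith a = a := by rw [e.inv_hom_id]; rfl
    have hb : (e.inv ≫ e.hom).arith b = b := by rw [e.inv_hom_id]; rfl
    rw [← ha, ← hb, FundamentalExtension.comp_arith]
    exact congrArg e.hom.arith (Subsingleton.elim _ _)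
  have hmax : ∀ F : FundamentalExtension.{0}, Subsingleton F.arith → IsMaxTopFGClosedNormal F.geom := by
    intro F hF
    exact
      { normal := inferInstanceAs F.aug.toMonoidHom.ker.Normal
        isClosed := F.isClosed_geom
        topFG := ⟨∅, eq_top_iff.mpr fun x _ => by rw [Subsingleton.elim x 1]; exact one_mem _⟩
        maximal := fun N _ _ _ x _ => by rw [Subsingleton.elim x 1]; exact one_mem _ }
  let V : ∀ F : FundamentalExtension.{0}, GaloisProSet F.arith := fun F =>
    letI : MulAction F.arith Bool :=
      { smul := fun _ v => v, one_smul := fun _ => rfl, mul_smul := fun _ _ _ => rfl }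
    haveI : ContinuousSMul F.arith Bool := ⟨continuous_snd⟩
    { carrier := Bool
      generic := false
      non := {true}
      arc := ∅
      smul_generic := fun _ => rfl
      generic_notMem_non := by simp
      generic_notMem_arc := fun h => h
      disjoint_non_arc := by simp
      eq_generic_or_mem := fun v => by cases v <;> simp
      smul_mem_non := fun _ _ h => h
      smul_mem_arc := fun _ _ h => h }
  let σ : Bool ≃ₜ Bool :=
    { toFun := not, invFun := not, left_inv := Bool.not_not, right_inv := Bool.not_not,
      continuous_toFun := continuous_of_discreteTopology
      continuous_invFun := continuous_of_discreteTopology }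
  refine ⟨{ IsAdmissible := fun F => Subsingleton F.arith
            isAdmissible_of_iso := hiso
            geom_isMax := hmax
            kNF := fun _ => ℚ
            instField := fun _ => inferInstance
            instAction := fun F => MulSemiringAction.compHom _ (1 : F.arith →* (ℚ →+* ℚ))
            proVal := V
            archSpace := fun _ v => v.2.elim
            δell := fun _ v => v.2.elim
            κell := fun _ v => v.2.elim
            mapProVal := fun _ _ => σ
            mapProVal_smul := fun _ _ _ _ => rfl
            mapKNF := fun _ _ => RingEquiv.refl ℚ },
    E₁, inferInstanceAs (Subsingleton PUnit), true, rfl, ?_⟩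
  -- `[n] = [⊚]`: `⊚ = false ↦ true = n` under `V⊚(𝟙 Π) = not`
  refine (Quot.sound ?_).symm
  exact ⟨Iso.refl E₁, isEAHom_id E₁, rfl⟩

/-! ### §4 The four universal closures are refuted -/

/-- **F-0176: the universal closure of `AutRel` is FALSE** — `AutRel R E` is the RELATION "`w = α·v` for some
`α ∈ Aut(Π)`" of Def 5.1 (ii) (vocabulary: the quotient `V⊚(Π)/Aut(Π)` is `Quot` of it), not an assertion; in the
context `R✗`, `⊚` and the nonarchimedean element are not related.  Instance forms: `autRel_mapProVal`,
`nonempty_decompGrp_equiv_of_toModAut_eq` (sibling file). [cite: MochizukiAbsTopIII2015, Def 5.1 (ii) p. 115] -/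
theorem not_forall_autRel :
    ¬ ∀ (R : GlobalAnabelianContext.{0}) (E : FundamentalExtension.{0}) (v w : (R.proVal E).carrier),
      R.AutRel E v w := by
  obtain ⟨R, E, -, -, -, -, -, -, ⟨v, w, hvw⟩, -⟩ := GlobalAnabelianContext.exists_context_arcSwap
  exact fun h => hvw (h R E v w)

/-- **F-0182: the universal closure of `PanalocalizationExists` is FALSE** — in the context `R₀` the nonarchimedean
element is `Aut(Π)`-conjugate to `⊚`, which condition (a) of Def 5.1 (iv) (`⊚ ↦ ⊚_V ∉ V^non ∋` the image of `n`)
forbids (`PanalocalizationExists.toModAut_ne_of_mem_non`).  Instance form: `panalocalizationExists_of_mapProVal_mem`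
(every context in which `Aut(Π)` respects `⊚ / non / arc`, as in print). [cite: MochizukiAbsTopIII2015, Cor 5.2 (v) p. 120] -/
theorem not_forall_panalocalizationExists : ¬ ∀ R : GlobalAnabelianContext.{0}, PanalocalizationExists R := by
  obtain ⟨R, E, hE, v, hv, hq⟩ := GlobalAnabelianContext.exists_context_genericSwap
  exact fun h => (h R).toModAut_ne_of_mem_non hE hv hq

/-- **A context in which F-0182 HOLDS while F-0181 (for every archimedean datum `ma`) and F-0183 FAIL** (`R✗`):
the failures below are not artefacts of vacuity. [cite: MochizukiAbsTopIII2015, Cor 5.2 (v) p. 120] -/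
theorem exists_context_panalocalizationExists_and_not :
    ∃ R : GlobalAnabelianContext.{0}, PanalocalizationExists R ∧
      (∀ ma : ArchMonoAnalyticization.{0}, ¬ MonoAnalyticizationExists R ma) ∧ ¬ PanalocalizationMapsHom R := by
  obtain ⟨R, E, hE, hgal, hgen, hnon, harc, ⟨v, hv⟩, -, hone, ⟨a, b, hab⟩⟩ :=
    GlobalAnabelianContext.exists_context_arcSwap
  have hPan : PanalocalizationExists R :=
    panalocalizationExists_of_mapProVal_mem R (fun E _ => hgen E) (fun E _ => hnon E) (fun E _ => harc E)
  refine ⟨R, hPan, fun ma h => ?_, fun h => hab (h.nonempty_iso_archSpace hE (hgen E) (hnon E) (harc E) hone a b)⟩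
  -- F-0181: a panalocalization of `V⊚(Π)` has the nonarchimedean element `[n]`; its `G_w ≅ aug(Π_ñ) ⊆ G = 1` would be
  -- the (infinite) absolute Galois group of an MLF
  obtain ⟨P, _, ψ, -, hPnon, -⟩ := hPan E hE
  obtain ⟨E', hE', vl, -, k, _, _, hk, ⟨e⟩⟩ := h.exists_isMLFGaloisType P ⟨ψ (R.toModAut E v), hPnon v hv⟩
  haveI := hgal E' hE'
  haveI : Subsingleton (R.galDecompGrp E' vl) := ⟨fun x y => Subtype.ext (Subsingleton.elim x.1 y.1)⟩
  haveI : Subsingleton (absoluteGaloisGrp k) := e.symm.injective.subsingleton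
  haveI := hk.infinite_absoluteGaloisGroup
  exact false_of_nontrivial_of_subsingleton (Field.absoluteGaloisGroup k)

/-- **F-0183: the universal closure of `PanalocalizationMapsHom` is FALSE** — in `R✗` the identity of `Π` induces no
morphism between the two panalocalizations of `V⊚(Π)` that choose the lifts `a` resp. `a′ = (a a′)·a` of the unique
archimedean class, since `X(Π, a) ≇ X(Π, a′)` (§1).  Print has `X(Π, ṽ) = X_{ell,ṽ}` functorial in `(Π, ṽ)` (Cor 2.8);
the interface records it as free data. [cite: MochizukiAbsTopIII2015, Def 5.1 (iv) p. 116] -/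
theorem not_forall_panalocalizationMapsHom : ¬ ∀ R : GlobalAnabelianContext.{0}, PanalocalizationMapsHom R := by
  obtain ⟨R, -, -, hR⟩ := exists_context_panalocalizationExists_and_not
  exact fun h => hR (h R)

/-- **F-0181: the universal closure of `MonoAnalyticizationExists` is FALSE** — in `R✗` (where panalocal
Galois-theaters with a nonarchimedean element exist) a mono-analyticization would make `G_w ≅ aug(Π_ñ) = 1` an object
of `TG⊢`, but the absolute Galois group of an MLF is infinite (`IsMLF.infinite_absoluteGaloisGroup`); the archimedean
datum `ma` is irrelevant (stated for all `ma`, closed with `ArchMonoAnalyticization.nonempty_degenerate`).  Instance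
form: `monoAnalyticizationExists_of_isMLFGaloisType` (every context whose `G_ṽ` are of MLF-Galois type, as in print).
[cite: MochizukiAbsTopIII2015, Def 5.6 (ii) p. 135] -/
theorem not_forall_monoAnalyticizationExists :
    ¬ ∀ (R : GlobalAnabelianContext.{0}) (ma : ArchMonoAnalyticization.{0}), MonoAnalyticizationExists R ma := by
  obtain ⟨ma⟩ := ArchMonoAnalyticization.nonempty_degenerate
  obtain ⟨R, -, hR, -⟩ := exists_context_panalocalizationExists_and_not
  exact fun h => hR ma (h R ma)

end Literature.AnabelianGeometry.AbsoluteAnabelian
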